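import Mathlib
import Literature.Analysis.FluidPDE.SuitableWeak
import Literature.Analysis.FluidPDE.Seregin2023.TypeIIEulerZoomScenario
import HarnessLib

/-!
# The genuine-supremum representative of Seregin's Euler limit
# (route №10 `EulerZoomLiouville`, support item Z = stmt-NavierStokesRegularity-19834, piece (e), part 3)

Helper file (theorems only; `--supports stmt-NavierStokesRegularity-19834`). Seat ns-typeII-p3
(cell ns-regularity-ideate §B, D-0081; DIRECTOR-NS g6 #3: the Summits-side half of Z).

Seregin's bound (3.5) (arXiv:2606.29468, Thm 3.1) controls the scaled energy of the Euler limit as an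
ESSENTIAL supremum in time (tree `weightedA`), whereas the class of the route decl
`EulerZoomLiouville.PowerGaugeEulerLiouville` / `SereginZoomReduction` uses the CKN quantity `cknA`, a
GENUINE supremum over the times of the window (refuter1's JUNK note and typeII-lit-1's diff (5):
«Z must deliver a good representative»).  This file delivers it (`exists_sup_representative`): zero
out `u` on the null set `N` of times at which the weighted slice energy exceeds the bound for SOME
positive RATIONAL radius; the modified field `1_{Nᶜ} u` agrees with `u` a.e. on space–time, and for
every real radius `a > 0` and every time `τ ∈ ]−a², 0[` off `N` the bound at the rationals
`q ↑ a` with `q² > −τ` passes to `a` because `q^{2ρ−1} ≥ a^{2ρ−1}` for `ρ ≤ 1/2` (monotone union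
of the balls `B_q`), so that `a^{2ρ} · cknA(a) ≤ c` with the genuine supremum.
WHAT THIS IS NOT: not NS regularity and not Seregin's compactness theorem — bookkeeping for a
reduction modulo the typed printed fact. [folklore]
-/

noncomputable section

-- the summit and its single problem share the name `NavierStokesRegularity` (D-0017 nested layout)
set_option linter.dupNamespace false

open Set Function Filter Topology MeasureTheory Metric TopologicalSpace
open scoped NNReal ENNReal InnerProductSpace RealInnerProductSpace

namespace Summit.NavierStokesRegularity.NavierStokesRegularity.Theorems.SereginZoomReduction

open Literature.Analysis Literature.Analysis.FluidPDE Literature.Analysis.FluidPDE.Seregin2023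

/-! ## The bad set of times -/

/-- **The bad times are null.**  For each positive rational radius `q` the times `τ ∈ ]−q², 0[` at
which `(q^ρ)²/q · ∫_{B_q} |u(τ)|²` exceeds the essential supremum bound `c` form a null set; so does
their union over `q`. [folklore] -/
theorem volume_badTimes_eq_zero {ρ : ℝ} {c : ℝ≥0} {u : ℝ → EuclideanSpace ℝ (Fin 3) → EuclideanSpace ℝ (Fin 3)}
    (hA : ∀ a : ℝ, 0 < a → weightedA (fun r => r ^ ρ) a (0 : ℝ × EuclideanSpace ℝ (Fin 3)) u ≤ (c : ℝ≥0∞)) :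
    volume (⋃ q : ℚ, {τ : ℝ | 0 < (q : ℝ) ∧ τ ∈ Ioo (-((q : ℝ) ^ 2)) 0 ∧
      ¬ (ENNReal.ofReal (((q : ℝ) ^ ρ) ^ 2 / (q : ℝ)) *
          ∫⁻ x in ball (0 : EuclideanSpace ℝ (Fin 3)) (q : ℝ), ‖u τ x‖ₑ ^ 2 ≤ (c : ℝ≥0∞))}) = 0 := by
  refine measure_iUnion_null fun q => ?_
  by_cases hq : 0 < (q : ℝ)
  · have h1 : ∀ᵐ τ ∂(volume.restrict (Ioo ((0 : ℝ × EuclideanSpace ℝ (Fin 3)).1 - (q : ℝ) ^ 2)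
        (0 : ℝ × EuclideanSpace ℝ (Fin 3)).1)),
        ENNReal.ofReal (((q : ℝ) ^ ρ) ^ 2 / (q : ℝ)) *
          ∫⁻ x in ball (0 : ℝ × EuclideanSpace ℝ (Fin 3)).2 (q : ℝ), ‖u τ x‖ₑ ^ 2 ≤ (c : ℝ≥0∞) :=
      (ae_le_essSup).mono fun τ hτ => hτ.trans (hA q hq)
    have hset : Ioo ((0 : ℝ × EuclideanSpace ℝ (Fin 3)).1 - (q : ℝ) ^ 2) (0 : ℝ × EuclideanSpace ℝ (Fin 3)).1 =
        Ioo (-((q : ℝ) ^ 2)) 0 := by simp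
    rw [hset, ae_restrict_iff' measurableSet_Ioo, ae_iff] at h1
    refine measure_mono_null (fun τ hτ => ?_) h1
    simp only [mem_setOf_eq] at hτ ⊢
    exact fun h => hτ.2.2 (h hτ.2.1)
  · convert measure_empty (μ := (volume : Measure ℝ))
    ext τ
    simp only [mem_setOf_eq, mem_empty_iff_false, iff_false, not_and]
    exact fun h => (hq h).elim

/-! ## The slice estimate off the bad set -/

/-- **Off the bad times, the scaled slice energy obeys the bound at EVERY real radius** (`ρ ≤ 1/2`):
if `τ ∈ ]−a², 0[` is good, pick rationals `q_k ↑ a` with `q_k > √(−τ)`; the bound at `q_k` and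
`q_k^{2ρ−1} ≥ a^{2ρ−1}` give `a^{2ρ−1} ∫_{B_{q_k}} |u(τ)|² ≤ c`, and `B_{q_k} ↑ B_a`. [folklore] -/
theorem slice_gauge_le_of_good {ρ : ℝ} (hρ : ρ ≤ 1 / 2) {c : ℝ≥0}
    {u : ℝ → EuclideanSpace ℝ (Fin 3) → EuclideanSpace ℝ (Fin 3)} {a τ : ℝ} (ha : 0 < a)
    (hτa : -(a ^ 2) < τ) (hτ0 : τ < 0)
    (hgood : ∀ q : ℚ, 0 < (q : ℝ) → τ ∈ Ioo (-((q : ℝ) ^ 2)) 0 →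
      ENNReal.ofReal (((q : ℝ) ^ ρ) ^ 2 / (q : ℝ)) *
        ∫⁻ x in ball (0 : EuclideanSpace ℝ (Fin 3)) (q : ℝ), ‖u τ x‖ₑ ^ 2 ≤ (c : ℝ≥0∞)) :
    ENNReal.ofReal (a ^ (2 * ρ)) * ((ENNReal.ofReal a)⁻¹ *
      ∫⁻ x in ball (0 : EuclideanSpace ℝ (Fin 3)) a, ‖u τ x‖ₑ ^ 2) ≤ (c : ℝ≥0∞) := by
  -- `δ = a − √(−τ) > 0`
  set s : ℝ := Real.sqrt (-τ) with hs
  have hs0 : 0 ≤ s := Real.sqrt_nonneg _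
  have hs2 : s ^ 2 = -τ := Real.sq_sqrt (by linarith)
  have hsa : s < a := by nlinarith
  set δ : ℝ := a - s with hδ
  have hδ0 : 0 < δ := by linarith
  -- rationals `q_k ∈ ]a − δ/(k+1), a − δ/(k+2)[`
  have hex : ∀ k : ℕ, ∃ q : ℚ, a - δ / ((k : ℝ) + 1) < (q : ℝ) ∧ (q : ℝ) < a - δ / ((k : ℝ) + 2) := by
    intro k
    have hlt : a - δ / ((k : ℝ) + 1) < a - δ / ((k : ℝ) + 2) := by
      have h1 : δ / ((k : ℝ) + 2) < δ / ((k : ℝ) + 1) :=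
        div_lt_div_of_pos_left hδ0 (by positivity) (by linarith)
      linarith
    obtain ⟨q, hq1, hq2⟩ := exists_rat_btwn hlt
    exact ⟨q, hq1, hq2⟩
  choose q hq using hex
  have hq_gt : ∀ k, s < (q k : ℝ) := by
    intro k
    have h1 : δ / ((k : ℝ) + 1) ≤ δ := div_le_self hδ0.le (by linarith [(Nat.cast_nonneg k : (0 : ℝ) ≤ k)])
    linarith [(hq k).1]
  have hq_pos : ∀ k, 0 < (q k : ℝ) := fun k => lt_of_le_of_lt hs0 (hq_gt k)
  have hq_lt : ∀ k, (q k : ℝ) < a := by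
    intro k
    have h1 : 0 < δ / ((k : ℝ) + 2) := by positivity
    linarith [(hq k).2]
  have hq_mono : Monotone fun k => ball (0 : EuclideanSpace ℝ (Fin 3)) (q k : ℝ) := by
    refine monotone_nat_of_le_succ fun k => ball_subset_ball ?_
    have h1 := (hq (k + 1)).1
    have h2 := (hq k).2
    push_cast at h1
    rw [show (k : ℝ) + 1 + 1 = (k : ℝ) + 2 by ring] at h1
    linarith
  have hU : (⋃ k : ℕ, ball (0 : EuclideanSpace ℝ (Fin 3)) (q k : ℝ)) = ball (0 : EuclideanSpace ℝ (Fin 3)) a := by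
    refine Subset.antisymm (iUnion_subset fun k => ball_subset_ball (hq_lt k).le) fun x hx => ?_
    rw [mem_ball_zero_iff] at hx
    obtain ⟨k, hk⟩ := exists_nat_gt (δ / (a - ‖x‖))
    refine mem_iUnion.2 ⟨k, mem_ball_zero_iff.2 ?_⟩
    have hax : 0 < a - ‖x‖ := by linarith
    have h1 : δ / ((k : ℝ) + 1) < a - ‖x‖ := by
      rw [div_lt_iff₀ (by positivity)]
      rw [div_lt_iff₀ hax] at hk
      nlinarith
    linarith [(hq k).1]
  -- the bound at each `q_k`, with the weight lowered to `a^{2ρ−1}`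
  have hw : ENNReal.ofReal (a ^ (2 * ρ)) * (ENNReal.ofReal a)⁻¹ = ENNReal.ofReal (a ^ (2 * ρ - 1)) := by
    rw [← ENNReal.ofReal_inv_of_pos ha, ← ENNReal.ofReal_mul (Real.rpow_nonneg ha.le _),
      Real.rpow_sub ha, Real.rpow_one, div_eq_mul_inv]
  have hk : ∀ k, ENNReal.ofReal (a ^ (2 * ρ - 1)) *
      ∫⁻ x in ball (0 : EuclideanSpace ℝ (Fin 3)) (q k : ℝ), ‖u τ x‖ₑ ^ 2 ≤ (c : ℝ≥0∞) := by
    intro k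
    have hmem : τ ∈ Ioo (-((q k : ℝ) ^ 2)) 0 := by
      refine ⟨?_, hτ0⟩
      have := hq_gt k
      nlinarith
    refine le_trans (mul_le_mul' ?_ le_rfl) (hgood (q k) (hq_pos k) hmem)
    refine ENNReal.ofReal_le_ofReal ?_
    rw [← Real.rpow_mul_natCast (hq_pos k).le, show ρ * ((2 : ℕ) : ℝ) = 2 * ρ by push_cast; ring,
      div_eq_mul_inv, ← Real.rpow_neg_one, ← Real.rpow_add (hq_pos k), show 2 * ρ + -1 = 2 * ρ - 1 by ring]
    exact Real.rpow_le_rpow_of_nonpos (hq_pos k) (hq_lt k).le (by linarith)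
  -- pass to the limit `B_{q_k} ↑ B_a`
  rw [← mul_assoc, hw, ← hU, setLIntegral_iUnion_of_directed _ hq_mono.directed_le, ENNReal.mul_iSup]
  exact iSup_le hk

/-! ## The representative -/

/-- **The genuine-supremum representative.**  If `A_F(u, a) ≤ c` for all `a > 0` (essential supremum,
`F(a) = a^ρ`, `ρ ≤ 1/2`), there is a null set of times `N` such that the field `1_{Nᶜ}(τ) u(τ, ·)`
agrees with `u` a.e. on space–time and obeys `a^{2ρ} · cknA(a; 0) ≤ c` (GENUINE supremum) for all
`a > 0`. [folklore] -/
theorem exists_sup_representative {ρ : ℝ} (hρ : ρ ≤ 1 / 2) {c : ℝ≥0}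
    {u : ℝ → EuclideanSpace ℝ (Fin 3) → EuclideanSpace ℝ (Fin 3)}
    (hA : ∀ a : ℝ, 0 < a → weightedA (fun r => r ^ ρ) a (0 : ℝ × EuclideanSpace ℝ (Fin 3)) u ≤ (c : ℝ≥0∞)) :
    ∃ N : Set ℝ, volume N = 0 ∧
      (uncurry (Nᶜ.indicator u) =ᵐ[volume] uncurry u) ∧
      ∀ a : ℝ, 0 < a →
        ENNReal.ofReal (a ^ (2 * ρ)) * cknA a (0 : ℝ × EuclideanSpace ℝ (Fin 3)) (Nᶜ.indicator u) ≤
          (c : ℝ≥0∞) := by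
  set N : Set ℝ := ⋃ q : ℚ, {τ : ℝ | 0 < (q : ℝ) ∧ τ ∈ Ioo (-((q : ℝ) ^ 2)) 0 ∧
      ¬ (ENNReal.ofReal (((q : ℝ) ^ ρ) ^ 2 / (q : ℝ)) *
          ∫⁻ x in ball (0 : EuclideanSpace ℝ (Fin 3)) (q : ℝ), ‖u τ x‖ₑ ^ 2 ≤ (c : ℝ≥0∞))} with hN
  have hN0 : volume N = 0 := volume_badTimes_eq_zero hA
  refine ⟨N, hN0, ?_, ?_⟩
  · -- a.e. equality on space–time: the fields differ only on `N × ℝ³`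
    have hnull : volume (N ×ˢ (univ : Set (EuclideanSpace ℝ (Fin 3)))) = 0 := by
      rw [Measure.volume_eq_prod, Measure.prod_prod, hN0, zero_mul]
    refine (ae_iff.2 (measure_mono_null (fun z hz => ?_) hnull))
    simp only [mem_setOf_eq] at hz
    by_contra hmem
    apply hz
    have hτ : z.1 ∉ N := fun h => hmem (mem_prod.2 ⟨h, mem_univ _⟩)
    simp [uncurry, indicator_of_mem (mem_compl hτ)]
  · intro a ha
    unfold cknA
    simp only [ENNReal.mul_iSup]
    refine iSup₂_le fun τ hτ => ?_
    have hτ' : τ ∈ Ioo (-(a ^ 2)) 0 := by simpa using hτ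
    by_cases hbad : τ ∈ N
    · have h0 : Nᶜ.indicator u τ = 0 := indicator_of_notMem (fun h : τ ∈ Nᶜ => h hbad) _
      simp [h0]
    · have h1 : Nᶜ.indicator u τ = u τ := indicator_of_mem (mem_compl hbad) _
      rw [h1]
      refine slice_gauge_le_of_good hρ ha hτ'.1 hτ'.2 fun q hq hmem => ?_
      by_contra hcon
      exact hbad (mem_iUnion.2 ⟨q, hq, hmem, hcon⟩)

end Summit.NavierStokesRegularity.NavierStokesRegularity.Theorems.SereginZoomReduction

end
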